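import Summits.QuantumFields.YangMills.Theorems.SwapVirialDeficitZeroModeGroupFourSmallBallDominatorSet
import Summits.QuantumFields.YangMills.Theorems.SwapVirialDeficitZeroModeGroupThreeGaussian
import HarnessLib

/-!
# Exact zero-mode rung, FOUR pairwise nearly commuting letters — IV-b: fibre volumes of the uniform dominating event
# (zero-mode block of crux ⟨stmt-QuantumFields-24497⟩ `ToronTubeVolumeLaw`; free-hands support of ⟨stmt-QuantumFields-24197⟩ / ⟨24497⟩)

Toward the majorant for dominated convergence in the two-scale family (`vol³(domSet4) < ∞`, part IV-c): over the reference letter `x` (largest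
transverse size `ρ² = tvSq x`) each other letter lives in `fibre4 x` (IV-a), and this file bounds its volume TWICE, in the coordinates ✓`coord4` of
w2 g55: §14 the transverse cutoff set `Pset x` has area `≤ 4ρ²` and `≤ 4√2·ρ/|x_I|` (in the larger coordinate of `(x_J, x_K)` the pair constraint is a
strip of width `≤ 2√2/|x_I|`); §15 the `I`-coordinate of a fibre letter is confined to an interval of length `2/ρ`, so ★ `volume_fibre4_le_sqrt :
vol(fibre4 x) ≤ 16ρ` and ★ `volume_fibre4_le_inv : vol(fibre4 x) ≤ 16√2/|x_I|` — the square of their minimum is integrable in `x_I ∈ ℝ` (IV-c).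
HONEST LABEL: finite-dimensional measure theory on `SU(2)⁴` (plan-level zero-mode rung of DRAFT lines); NOT ⟨24497⟩, NOT ⟨24197⟩; the Yang–Mills mass gap
is NOT proved; no summit is proved by a line.  Seat ym-line-fcl-p3 g44 (cell ym-idea-1, free hands), `--supports stmt-QuantumFields-24197`.  Standard axioms (auxiliary defs `Pset`, `cI`, `fibreBox`).  References: [cite: GonzalezarroyoAltes1988]; [cite: Vanbaal2001]; [cite: Luscher1983, §2]; [folklore].
-/

set_option autoImplicit false

noncomputable section

open MeasureTheory Quaternion Set Real
open scoped Quaternion ENNReal BigOperators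
open Literature.MathematicalPhysics.QuantumLattice
open Summit.QuantumFields.YangMills.Theorems.SwapTwistDeficit.ToronLog

attribute [local instance] Literature.Analysis.FluidPDE.Tao2016.quatMeasurableSpace
  Literature.Analysis.FluidPDE.Tao2016.quatBorelSpace
  Literature.MathematicalPhysics.QuantumLattice.secondCountableTopology_su2

namespace Summit.QuantumFields.YangMills.Theorems.SwapVirialDeficit.ZeroModeGroup

/-! ## §14 The transverse cutoff set of the fibre and its two area bounds -/

/-- The transverse part `(z_J, z_K)` of a fibre letter: `z_J², z_K² ≤ ρ²` and the cutoff `x_I²(x_Jz_K − x_Kz_J)² ≤ ρ²`, `ρ² = tvSq x`. [folklore] -/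
def Pset (x : ℍ) : Set (ℝ × ℝ) := {q | q.1 ^ 2 ≤ tvSq x ∧ q.2 ^ 2 ≤ tvSq x ∧ x.imI ^ 2 * (x.imJ * q.2 - x.imK * q.1) ^ 2 ≤ tvSq x}

/-- `Pset x` is measurable. [folklore] -/
theorem measurableSet_Pset (x : ℍ) : MeasurableSet (Pset x) := by
  have h3 : Measurable fun q : ℝ × ℝ => x.imI ^ 2 * (x.imJ * q.2 - x.imK * q.1) ^ 2 :=
    (((measurable_snd.const_mul _).sub (measurable_fst.const_mul _)).pow_const 2).const_mul _
  unfold Pset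
  exact (measurableSet_le (measurable_fst.pow_const 2) measurable_const).inter
    ((measurableSet_le (measurable_snd.pow_const 2) measurable_const).inter (measurableSet_le h3 measurable_const))

/-- `v² ≤ r` means `v ∈ [−√r, √r]`. [folklore] -/
theorem mem_Icc_of_sq_le {v r : ℝ} (h : v ^ 2 ≤ r) : v ∈ Icc (-Real.sqrt r) (Real.sqrt r) := by
  have hr : 0 ≤ r := le_trans (sq_nonneg v) h
  have hab : |v| ≤ Real.sqrt r := by rw [← Real.sqrt_sq_eq_abs]; exact Real.sqrt_le_sqrt h
  exact ⟨by linarith [(abs_le.1 hab).1], (abs_le.1 hab).2⟩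

/-- First area bound: `area(Pset x) ≤ 4ρ²`. [folklore] -/
theorem volume_Pset_le_sq (x : ℍ) : volume (Pset x) ≤ ENNReal.ofReal (4 * tvSq x) := by
  have hsub : Pset x ⊆ Icc (-Real.sqrt (tvSq x)) (Real.sqrt (tvSq x)) ×ˢ Icc (-Real.sqrt (tvSq x)) (Real.sqrt (tvSq x)) := by
    rintro ⟨u, v⟩ ⟨h1, h2, -⟩; exact ⟨mem_Icc_of_sq_le h1, mem_Icc_of_sq_le h2⟩
  calc volume (Pset x) ≤ volume (Icc (-Real.sqrt (tvSq x)) (Real.sqrt (tvSq x)) ×ˢ Icc (-Real.sqrt (tvSq x)) (Real.sqrt (tvSq x))) :=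
        measure_mono hsub
    _ = ENNReal.ofReal (4 * tvSq x) := by
        rw [Measure.volume_eq_prod, Measure.prod_prod, Real.volume_Icc, ← ENNReal.ofReal_mul (by linarith [Real.sqrt_nonneg (tvSq x)])]
        congr 1
        have := Real.mul_self_sqrt (tvSq_nonneg x)
        nlinarith

/-- The 1-D strip: `{v | e²(a v − b)² ≤ r} ⊆ [b/a − √r/(|e||a|), b/a + √r/(|e||a|)]` (`e, a ≠ 0`), of length `2√r/(|e||a|)`. [folklore] -/
theorem volume_strip_le {e a : ℝ} (he : e ≠ 0) (ha : a ≠ 0) (b r : ℝ) :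
    volume {v : ℝ | e ^ 2 * (a * v - b) ^ 2 ≤ r} ≤ ENNReal.ofReal (2 * Real.sqrt r / (|e| * |a|)) := by
  have hea : 0 < |e| * |a| := mul_pos (abs_pos.2 he) (abs_pos.2 ha)
  have hsub : {v : ℝ | e ^ 2 * (a * v - b) ^ 2 ≤ r} ⊆ Icc (b / a - Real.sqrt r / (|e| * |a|)) (b / a + Real.sqrt r / (|e| * |a|)) := by
    intro v hv
    simp only [Set.mem_setOf_eq] at hv
    have h1 : |e * (a * v - b)| ≤ Real.sqrt r := by
      rw [← Real.sqrt_sq_eq_abs]; exact Real.sqrt_le_sqrt (by rw [mul_pow]; exact hv)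
    rw [abs_mul] at h1
    have h2 : |a * v - b| ≤ Real.sqrt r / |e| := by
      rw [le_div_iff₀ (abs_pos.2 he)]; linarith [mul_comm |e| |a * v - b|]
    have e3 : a * v - b = a * (v - b / a) := by field_simp
    rw [e3, abs_mul] at h2
    have h4 : |v - b / a| ≤ Real.sqrt r / (|e| * |a|) := by
      rw [le_div_iff₀ hea]
      calc |v - b / a| * (|e| * |a|) = |a| * |v - b / a| * |e| := by ring
        _ ≤ Real.sqrt r / |e| * |e| := mul_le_mul_of_nonneg_right h2 (abs_nonneg e)
        _ = Real.sqrt r := div_mul_cancel₀ _ (abs_ne_zero.2 he)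
    obtain ⟨k1, k2⟩ := abs_le.1 h4
    exact ⟨by linarith, by linarith⟩
  calc volume {v : ℝ | e ^ 2 * (a * v - b) ^ 2 ≤ r} ≤ volume (Icc (b / a - Real.sqrt r / (|e| * |a|)) (b / a + Real.sqrt r / (|e| * |a|))) :=
        measure_mono hsub
    _ = ENNReal.ofReal (2 * Real.sqrt r / (|e| * |a|)) := by rw [Real.volume_Icc]; congr 1; ring

/-- `|a| ≥ ρ/√2` when `a² ≥ ρ²/2`: then `2√(ρ²)/(|e||a|) ≤ 2√2/|e|`. [folklore] -/
theorem strip_width_le {e a ρ2 : ℝ} (he : e ≠ 0) (hρ : 0 < ρ2) (ha : ρ2 ≤ 2 * a ^ 2) :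
    2 * Real.sqrt ρ2 / (|e| * |a|) ≤ 2 * Real.sqrt 2 / |e| := by
  have hapos : 0 < |a| := abs_pos.2 (by rintro rfl; simp at ha; linarith)
  have hs : Real.sqrt ρ2 ≤ Real.sqrt 2 * |a| := by
    rw [← Real.sqrt_sq_eq_abs, ← Real.sqrt_mul (by norm_num : (0:ℝ) ≤ 2)]
    exact Real.sqrt_le_sqrt (by linarith)
  rw [div_le_div_iff₀ (mul_pos (abs_pos.2 he) hapos) (abs_pos.2 he)]
  calc 2 * Real.sqrt ρ2 * |e| ≤ 2 * (Real.sqrt 2 * |a|) * |e| := by gcongr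
    _ = 2 * Real.sqrt 2 * (|e| * |a|) := by ring

/-- Second area bound: `area(Pset x) ≤ 4√2·ρ/|x_I|` (`x_I ≠ 0`): in the larger of the two coordinates of `(x_J, x_K)` the cutoff is a strip of
width `≤ 2√2/|x_I|`, the other coordinate ranges over `[−ρ, ρ]`. [folklore] -/
theorem volume_Pset_le_inv {x : ℍ} (hI : x.imI ≠ 0) : volume (Pset x) ≤ ENNReal.ofReal (4 * Real.sqrt 2 * Real.sqrt (tvSq x) / |x.imI|) := by
  set ρ2 := tvSq x with hρ2
  rcases (tvSq_nonneg x).eq_or_lt with h0 | hpos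
  · -- degenerate reference letter: `Pset ⊆ {0}`
    have hsub : Pset x ⊆ {(0, 0)} := by
      rintro ⟨u, v⟩ ⟨h1, h2, -⟩
      have h0' : ρ2 = 0 := by rw [hρ2]; exact h0.symm
      have hu : u = 0 := by nlinarith [sq_nonneg u]
      have hv : v = 0 := by nlinarith [sq_nonneg v]
      simp [hu, hv]
    calc volume (Pset x) ≤ volume ({(0, 0)} : Set (ℝ × ℝ)) := measure_mono hsub
      _ = 0 := by rw [Measure.volume_eq_prod, show ({(0, 0)} : Set (ℝ × ℝ)) = {(0:ℝ)} ×ˢ {(0:ℝ)} by ext ⟨u, v⟩; simp,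
          Measure.prod_prod, Real.volume_singleton, zero_mul]
      _ ≤ _ := zero_le
  have hIcc : volume (Icc (-Real.sqrt ρ2) (Real.sqrt ρ2)) = ENNReal.ofReal (2 * Real.sqrt ρ2) := by rw [Real.volume_Icc]; congr 1; ring
  have hfin : ENNReal.ofReal (2 * Real.sqrt 2 / |x.imI|) * ENNReal.ofReal (2 * Real.sqrt ρ2) =
      ENNReal.ofReal (4 * Real.sqrt 2 * Real.sqrt (tvSq x) / |x.imI|) := by
    rw [← ENNReal.ofReal_mul (by positivity), hρ2]; congr 1; ring
  by_cases hJK : x.imK ^ 2 ≤ x.imJ ^ 2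
  · -- strip in the `K`-coordinate (inner), `J`-coordinate outer
    have hJ : x.imJ ≠ 0 := by
      intro h; rw [h] at hJK; have : tvSq x = 0 := by unfold tvSq; nlinarith [sq_nonneg x.imK]
      linarith
    have hJ2 : ρ2 ≤ 2 * x.imJ ^ 2 := by rw [hρ2, tvSq]; linarith
    rw [Measure.volume_eq_prod, Measure.prod_apply (measurableSet_Pset x)]
    have hsec : ∀ u : ℝ, volume (Prod.mk u ⁻¹' Pset x) ≤
        (Icc (-Real.sqrt ρ2) (Real.sqrt ρ2)).indicator (fun _ => ENNReal.ofReal (2 * Real.sqrt 2 / |x.imI|)) u := by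
      intro u
      by_cases hu : u ∈ Icc (-Real.sqrt ρ2) (Real.sqrt ρ2)
      · rw [Set.indicator_of_mem hu]
        have hsub : Prod.mk u ⁻¹' Pset x ⊆ {v : ℝ | x.imI ^ 2 * (x.imJ * v - x.imK * u) ^ 2 ≤ ρ2} := by
          intro v hv; exact hv.2.2
        exact (measure_mono hsub).trans ((volume_strip_le hI hJ (x.imK * u) ρ2).trans (ENNReal.ofReal_le_ofReal (strip_width_le hI hpos hJ2)))
      · rw [Set.indicator_of_notMem hu]
        have hemp : Prod.mk u ⁻¹' Pset x = ∅ := by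
          ext v; simp only [Set.mem_preimage, Set.mem_empty_iff_false, iff_false]
          intro hv; exact hu (mem_Icc_of_sq_le hv.1)
        rw [hemp, measure_empty]
    calc ∫⁻ u, volume (Prod.mk u ⁻¹' Pset x) ≤ ∫⁻ u, (Icc (-Real.sqrt ρ2) (Real.sqrt ρ2)).indicator (fun _ => ENNReal.ofReal (2 * Real.sqrt 2 / |x.imI|)) u :=
          lintegral_mono hsec
      _ = _ := by rw [lintegral_indicator measurableSet_Icc, setLIntegral_const, hIcc, hfin]
  · -- strip in the `J`-coordinate (inner), `K`-coordinate outer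
    have hKJ : x.imJ ^ 2 ≤ x.imK ^ 2 := (not_le.1 hJK).le
    have hK : x.imK ≠ 0 := by
      intro h; rw [h] at hKJ; have : tvSq x = 0 := by unfold tvSq; nlinarith [sq_nonneg x.imJ]
      linarith
    have hK2 : ρ2 ≤ 2 * x.imK ^ 2 := by rw [hρ2, tvSq]; linarith
    rw [Measure.volume_eq_prod, Measure.prod_apply_symm (measurableSet_Pset x)]
    have hsec : ∀ v : ℝ, volume ((fun u => (u, v)) ⁻¹' Pset x) ≤
        (Icc (-Real.sqrt ρ2) (Real.sqrt ρ2)).indicator (fun _ => ENNReal.ofReal (2 * Real.sqrt 2 / |x.imI|)) v := by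
      intro v
      by_cases hv : v ∈ Icc (-Real.sqrt ρ2) (Real.sqrt ρ2)
      · rw [Set.indicator_of_mem hv]
        have hsub : (fun u => (u, v)) ⁻¹' Pset x ⊆ {u : ℝ | x.imI ^ 2 * (x.imK * u - x.imJ * v) ^ 2 ≤ ρ2} := by
          intro u hu
          have h3 := hu.2.2
          simp only [Set.mem_setOf_eq]
          have e : (x.imK * u - x.imJ * v) ^ 2 = (x.imJ * v - x.imK * u) ^ 2 := by ring
          rw [e]; exact h3
        exact (measure_mono hsub).trans ((volume_strip_le hI hK (x.imJ * v) ρ2).trans (ENNReal.ofReal_le_ofReal (strip_width_le hI hpos hK2)))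
      · rw [Set.indicator_of_notMem hv]
        have hemp : (fun u => (u, v)) ⁻¹' Pset x = ∅ := by
          ext u; simp only [Set.mem_preimage, Set.mem_empty_iff_false, iff_false]
          intro hu; exact hv (mem_Icc_of_sq_le hu.2.1)
        rw [hemp, measure_empty]
    calc ∫⁻ v, volume ((fun u => (u, v)) ⁻¹' Pset x) ≤ ∫⁻ v, (Icc (-Real.sqrt ρ2) (Real.sqrt ρ2)).indicator (fun _ => ENNReal.ofReal (2 * Real.sqrt 2 / |x.imI|)) v :=
          lintegral_mono hsec
      _ = _ := by rw [lintegral_indicator measurableSet_Icc, setLIntegral_const, hIcc, hfin]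

/-! ## §15 The volume of a fibre -/

/-- The centre of the `I`-interval of a fibre letter as a function of its transverse part. [folklore] -/
def cI (x : ℍ) (q : ℝ × ℝ) : ℝ := x.imI * (x.imJ * q.1 + x.imK * q.2) / tvSq x

/-- `cI x` is continuous. [folklore] -/
theorem continuous_cI (x : ℍ) : Continuous (cI x) := by unfold cI; fun_prop

/-- The coordinate image of the fibre: `z₀ ∈ (−1, 1)`, `(z_J, z_K) ∈ Pset x`, `z_I ∈ [cI − 1/ρ, cI + 1/ρ]`. [folklore] -/
def fibreBox (x : ℍ) : Set (ℝ × (ℝ × (ℝ × ℝ))) :=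
  Ioo (-1 : ℝ) 1 ×ˢ {q : ℝ × (ℝ × ℝ) | q.2 ∈ Pset x ∧ cI x q.2 - 1 / Real.sqrt (tvSq x) ≤ q.1 ∧ q.1 ≤ cI x q.2 + 1 / Real.sqrt (tvSq x)}

/-- The second factor of `fibreBox` is measurable. [folklore] -/
theorem measurableSet_fibreBox_snd (x : ℍ) :
    MeasurableSet {q : ℝ × (ℝ × ℝ) | q.2 ∈ Pset x ∧ cI x q.2 - 1 / Real.sqrt (tvSq x) ≤ q.1 ∧ q.1 ≤ cI x q.2 + 1 / Real.sqrt (tvSq x)} := by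
  have hc : Measurable fun q : ℝ × (ℝ × ℝ) => cI x q.2 := (continuous_cI x).measurable.comp measurable_snd
  exact (measurable_snd (measurableSet_Pset x)).inter ((measurableSet_le (hc.sub measurable_const) measurable_fst).inter
    (measurableSet_le measurable_fst (hc.add measurable_const)))

/-- ★ The fibre lies in the coordinate box (`ρ² = tvSq x > 0`). [folklore] -/
theorem fibre4_subset_preimage_fibreBox {x : ℍ} (hρ : 0 < tvSq x) : fibre4 x ⊆ coord4 ⁻¹' fibreBox x := by
  intro z hz
  have hz' := hz
  obtain ⟨h1, h2, -⟩ := hz'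
  have hI := imI_mem_Icc_of_mem_fibre4 hz hρ
  refine ⟨?_, ⟨?_, ?_, ?_⟩, ?_, ?_⟩
  · show z.re ∈ Ioo (-1 : ℝ) 1
    have hab : |z.re| < 1 := (sq_lt_one_iff_abs_lt_one z.re).1 h1
    exact ⟨by linarith [(abs_lt.1 hab).1], (abs_lt.1 hab).2⟩
  · show z.imJ ^ 2 ≤ tvSq x
    have : z.imJ ^ 2 ≤ tvSq z := by unfold tvSq; nlinarith [sq_nonneg z.imK]
    linarith
  · show z.imK ^ 2 ≤ tvSq x
    have : z.imK ^ 2 ≤ tvSq z := by unfold tvSq; nlinarith [sq_nonneg z.imJ]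
    linarith
  · exact cross_sq_le_of_mem_fibre4 hz
  · show cI x (z.imJ, z.imK) - 1 / Real.sqrt (tvSq x) ≤ z.imI
    exact hI.1
  · show z.imI ≤ cI x (z.imJ, z.imK) + 1 / Real.sqrt (tvSq x)
    exact hI.2

/-- ★ **Fibre volume from the transverse area**: `vol(fibre4 x) ≤ 2·(2/ρ)·area(Pset x)` (`ρ² = tvSq x > 0`). [folklore] -/
theorem volume_fibre4_le_of_Pset {x : ℍ} (hρ : 0 < tvSq x) :
    volume (fibre4 x) ≤ ENNReal.ofReal 2 * (ENNReal.ofReal (2 / Real.sqrt (tvSq x)) * volume (Pset x)) := by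
  have hS := measurableSet_fibreBox_snd x
  have hbox : MeasurableSet (fibreBox x) := measurableSet_Ioo.prod hS
  have h1 : volume (fibre4 x) ≤ volume (coord4 ⁻¹' fibreBox x) := measure_mono (fibre4_subset_preimage_fibreBox hρ)
  rw [measurePreserving_coord4.measure_preimage hbox.nullMeasurableSet] at h1
  refine h1.trans ?_
  rw [fibreBox, Measure.volume_eq_prod, Measure.prod_prod, Real.volume_Ioo, show (1 : ℝ) - -1 = 2 by norm_num]
  gcongr
  -- the second factor: `I`-coordinate inner (an interval of length `2/ρ`), transverse part outer
  rw [Measure.volume_eq_prod, Measure.prod_apply_symm hS]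
  have hsec : ∀ q : ℝ × ℝ, volume ((fun u : ℝ => (u, q)) ⁻¹'
      {q : ℝ × (ℝ × ℝ) | q.2 ∈ Pset x ∧ cI x q.2 - 1 / Real.sqrt (tvSq x) ≤ q.1 ∧ q.1 ≤ cI x q.2 + 1 / Real.sqrt (tvSq x)}) ≤
      (Pset x).indicator (fun _ => ENNReal.ofReal (2 / Real.sqrt (tvSq x))) q := by
    intro q
    by_cases hq : q ∈ Pset x
    · rw [Set.indicator_of_mem hq]
      have hsub : (fun u : ℝ => (u, q)) ⁻¹'
          {q : ℝ × (ℝ × ℝ) | q.2 ∈ Pset x ∧ cI x q.2 - 1 / Real.sqrt (tvSq x) ≤ q.1 ∧ q.1 ≤ cI x q.2 + 1 / Real.sqrt (tvSq x)} ⊆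
          Icc (cI x q - 1 / Real.sqrt (tvSq x)) (cI x q + 1 / Real.sqrt (tvSq x)) := by
        intro u hu; exact ⟨hu.2.1, hu.2.2⟩
      refine (measure_mono hsub).trans ?_
      rw [Real.volume_Icc]; apply le_of_eq; congr 1; ring
    · rw [Set.indicator_of_notMem hq]
      have hemp : (fun u : ℝ => (u, q)) ⁻¹'
          {q : ℝ × (ℝ × ℝ) | q.2 ∈ Pset x ∧ cI x q.2 - 1 / Real.sqrt (tvSq x) ≤ q.1 ∧ q.1 ≤ cI x q.2 + 1 / Real.sqrt (tvSq x)} = ∅ := by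
        ext u; simp only [Set.mem_preimage, Set.mem_setOf_eq, Set.mem_empty_iff_false, iff_false, not_and]
        intro h; exact absurd h hq
      rw [hemp, measure_empty]
  calc _ ≤ ∫⁻ q, (Pset x).indicator (fun _ => ENNReal.ofReal (2 / Real.sqrt (tvSq x))) q := lintegral_mono hsec
    _ = _ := by rw [lintegral_indicator (measurableSet_Pset x), setLIntegral_const]

/-- A degenerate reference letter (`tvSq x = 0`) has a null fibre. [folklore] -/
theorem volume_fibre4_eq_zero {x : ℍ} (h0 : tvSq x = 0) : volume (fibre4 x) = 0 := by
  have hsub : fibre4 x ⊆ {z : ℍ | z.imJ = 0} := by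
    intro z hz
    obtain ⟨-, h2, -⟩ := hz
    rw [h0] at h2
    simp only [Set.mem_setOf_eq]
    unfold tvSq at h2
    nlinarith [sq_nonneg z.imJ, sq_nonneg z.imK]
  exact measure_mono_null hsub volume_imJ_eq_zero

/-- ★ **First fibre bound**: `vol(fibre4 x) ≤ 16ρ`, `ρ = √(tvSq x)`. [folklore] -/
theorem volume_fibre4_le_sqrt (x : ℍ) : volume (fibre4 x) ≤ ENNReal.ofReal (16 * Real.sqrt (tvSq x)) := by
  rcases (tvSq_nonneg x).eq_or_lt with h0 | hpos
  · rw [volume_fibre4_eq_zero h0.symm]; exact zero_le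
  have hs : 0 < Real.sqrt (tvSq x) := Real.sqrt_pos.2 hpos
  refine (volume_fibre4_le_of_Pset hpos).trans ?_
  calc ENNReal.ofReal 2 * (ENNReal.ofReal (2 / Real.sqrt (tvSq x)) * volume (Pset x))
      ≤ ENNReal.ofReal 2 * (ENNReal.ofReal (2 / Real.sqrt (tvSq x)) * ENNReal.ofReal (4 * tvSq x)) := by gcongr; exact volume_Pset_le_sq x
    _ = ENNReal.ofReal (16 * Real.sqrt (tvSq x)) := by
        rw [← ENNReal.ofReal_mul (by positivity), ← ENNReal.ofReal_mul (by positivity)]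
        congr 1
        set sr := Real.sqrt (tvSq x) with hsr
        have hs' : sr ≠ 0 := hs.ne'
        have e : tvSq x = sr ^ 2 := by rw [hsr, Real.sq_sqrt hpos.le]
        rw [e]
        field_simp
        ring

/-- ★ **Second fibre bound**: `vol(fibre4 x) ≤ 16√2/|x_I|` (`x_I ≠ 0`). [folklore] -/
theorem volume_fibre4_le_inv {x : ℍ} (hI : x.imI ≠ 0) : volume (fibre4 x) ≤ ENNReal.ofReal (16 * Real.sqrt 2 / |x.imI|) := by
  rcases (tvSq_nonneg x).eq_or_lt with h0 | hpos
  · rw [volume_fibre4_eq_zero h0.symm]; exact zero_le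
  have hs : 0 < Real.sqrt (tvSq x) := Real.sqrt_pos.2 hpos
  have ha : 0 < |x.imI| := abs_pos.2 hI
  refine (volume_fibre4_le_of_Pset hpos).trans ?_
  calc ENNReal.ofReal 2 * (ENNReal.ofReal (2 / Real.sqrt (tvSq x)) * volume (Pset x))
      ≤ ENNReal.ofReal 2 * (ENNReal.ofReal (2 / Real.sqrt (tvSq x)) * ENNReal.ofReal (4 * Real.sqrt 2 * Real.sqrt (tvSq x) / |x.imI|)) := by
        gcongr; exact volume_Pset_le_inv hI
    _ = ENNReal.ofReal (16 * Real.sqrt 2 / |x.imI|) := by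
        rw [← ENNReal.ofReal_mul (by positivity), ← ENNReal.ofReal_mul (by positivity)]
        congr 1
        have hs' : Real.sqrt (tvSq x) ≠ 0 := hs.ne'
        have ha' : |x.imI| ≠ 0 := ha.ne'
        field_simp
        ring

end Summit.QuantumFields.YangMills.Theorems.SwapVirialDeficit.ZeroModeGroup

end
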